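import Summits.AtomisticToContinuum.HydrodynamicLimit.Theorems.KinematicRungKinematicMeanClosureOnPath
import Summits.AtomisticToContinuum.HydrodynamicLimit.Theorems.KinematicRungDefs
import HarnessLib

/-!
# Route `KinematicRung`: the on-path lemmas, made visible to structural automation

The forward discipline (TRIBUNAL-FIT F4) asks every rung `C` of a forward route to come with a
LANDED on-path lemma `S → C`, landed *where the tribunal kernel's cheap `S → C` portfolio finds
it*. For this route both on-path lemmas are landed
(`KinematicMeanClosure_of_HydrodynamicLimit`, file `KinematicRungKinematicMeanClosureOnPath.lean`;
the whole graded family `meanClosureRung_of_hydrodynamicLimit k : HydrodynamicLimit →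
MeanClosureRung k`, file `KinematicRungDefs.lean`), but an untagged theorem is invisible to the
portfolio (`exact fun h => h` / `simpa` / `intro h; aesop` / `tauto` / projections `h.1`, `h _`):
the rung inserts its extra hypothesis three quantifier blocks deep, so no structural tactic
re-derives the 8-line term proof, and `aesop` only uses registered rules.

This file registers the two landed on-path lemmas as `aesop` **safe apply rules**. Both conclude
an opaque route/ladder constant (`KinematicRung.KinematicMeanClosure`, `MeanClosureRung k`), so
the rules fire only on goals that literally ask for a rung of this ladder, and then reduce it to
the Statement `HydrodynamicLimit` — exactly the content of the on-path lemma, now usable by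
`aesop` (hence by the kernel's `intro h; aesop`). Nothing concluding the Statement itself is
tagged (no rule makes `HydrodynamicLimit` easier to prove; strong-hypothesis probes `H → C` are
unaffected because the bridge `H → HydrodynamicLimit` is not an `aesop` rule).

It also records the graded-family form of on-path-ness as one equivalence: the Statement is the
bottom of the ladder and implies every rung, `HydrodynamicLimit ↔ ∀ k, MeanClosureRung k`.

The two `example`s at the end are the kernel's literal `S → C` goals for the rung `k = 2`
(the route's crux) and for the next rung down `k = 1`, closed by the kernel's literal portfolio
tactic `intro h; aesop`.

prover-fwd2-land-3-g2-0 (on-path lander, gen 2), 2026-08-18.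
-/

namespace Summit.AtomisticToContinuum.HydrodynamicLimit.Theorems

open Summit.AtomisticToContinuum.HydrodynamicLimit.Theses

attribute [aesop safe apply] KinematicMeanClosure_of_HydrodynamicLimit
  meanClosureRung_of_hydrodynamicLimit

/-- **The Statement is the bottom of the mean-closure ladder and implies every rung.**
`HydrodynamicLimit ↔ ∀ k, MeanClosureRung k`: `→` is the dial monotonicity from `k = 0`
(`meanClosureRung_of_hydrodynamicLimit`), `←` is the rung `k = 0` read back through
`meanClosureRung_zero_iff`. -/
theorem hydrodynamicLimit_iff_forall_meanClosureRung :
    _root_.HydrodynamicLimit ↔ ∀ k, MeanClosureRung k :=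
  ⟨fun h k => meanClosureRung_of_hydrodynamicLimit k h, fun h => meanClosureRung_zero_iff.1 (h 0)⟩

/-- **Every rung from the Statement, uniformly.** For all `k ≤ l`, the Statement gives rung `k`,
which gives rung `l`: the composite `S → Rung k → Rung l` of the two landed F4 facts
(`Rung 0 ↔ S`, `Rung_mono`), stated once so that a later seat citing "S implies the rung at any
level at or above `k`" has a single name for it. -/
theorem meanClosureRung_of_hydrodynamicLimit_of_le {k l : ℕ} (hkl : k ≤ l)
    (h : _root_.HydrodynamicLimit) : MeanClosureRung l :=
  (meanClosureRung_of_hydrodynamicLimit k h).mono hkl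

/- The kernel's literal forward `S → C` goals, closed by its literal portfolio tactic. -/
example : _root_.HydrodynamicLimit → KinematicRung.KinematicMeanClosure := by
  intro h; aesop

example : _root_.HydrodynamicLimit → MeanClosureRung 1 := by
  intro h; aesop

end Summit.AtomisticToContinuum.HydrodynamicLimit.Theorems
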